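import Mathlib.Probability.Distributions.Gaussian.Multivariate
import Mathlib.MeasureTheory.Group.IntegralConvolution
import Mathlib.MeasureTheory.Measure.Tilted
import Literature.MathematicalPhysics.QuantumFieldTheory.GaussianToolkit
import Literature.Barriers.CriticalPhenomena.RigorousRGSmallParameterTorusResolvent
import HarnessLib

/-!
# `RigorousRGSmallParameter` (Slade, Theorem 1.4.1): §4.1 "Progressive integration" PROVED —
# the Gaussian measure `P_C`, `⟨F⟩ = E_C(F Z_0)/E_C Z_0`, `Z_N = E_C θ Z_0`, and
# `E_{C''+C'} θ = E_{C''} θ ∘ E_{C'} θ`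

Companion of `RigorousRGSmallParameterTorusResolvent.lean` (`C⁻¹ = (-Δ_Λ)^{α/2} + m² ≻ 0`) and
`RigorousRGSmallParameterSusceptibilityFormula.lean` (`V = V_0 + ½(φ, C⁻¹φ)`, the unnormalised
convolution `gaussConvZ0`, Lemma 8.2.1) in the proof architecture of the barrier
`RigorousRGSmallParameter.lean`. Source: G. Slade, *Critical exponents for long-range `O(n)`
models below the upper critical dimension*, CMP 358 (2018), arXiv:1611.06169, §4.1
"Progressive integration" (held as TeX source; locators below are the displays of §4.1, quoted and
tagged [A]–[H]). This is the first step of the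
renormalisation-group set-up: the interacting measure is rewritten as a perturbation `Z_0` of the
Gaussian `P_C`, and the Gaussian integral `E_C θ Z_0` is to be performed progressively over a
covariance decomposition `C = Σ_j C_j` (§3). Mathlib-generic Gaussian input: Mathlib's
`multivariateGaussian` (characteristic function, covariance) and the tree's
`QuantumFieldTheory.GaussianToolkit` (Lebesgue density of a non-degenerate multivariate Gaussian).

## What the source prints (§4.1)

* "For `n ≥ 1`, given a `Λ × Λ` covariance matrix `C`, let `P_C` denote the Gaussian probability
  measure on `(ℝⁿ)^Λ` with covariance `C`. This means that `P_C` is proportional to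
  `e^{-½ Σ_{i=1}^n Σ_{x,y∈Λ} φ_xⁱ C⁻¹_{xy} φ_yⁱ} Π_{x∈Λ} dφ_x` (properly interpreted when `C` is only
  positive semi-definite rather than positive-definite). Let `E_C` denote the corresponding
  expectation. … With `m² > 0` and `C = ((-Δ_{Λ_N})^{α/2} + m²)⁻¹`, we can rewrite the
  expectation as [A] `⟨F⟩_{g,ν,N} = E_C F Z_0 / E_C Z_0`", where
  `g_0 = g`, `ν_0 = ν - m²`, `V_0(φ_x) = g_0τ_x² + ν_0τ_x`, `Z_0(φ) = e^{-V_0(Λ_N)}`.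
* "we write `E_C θ F` for the convolution of `F` with `P_C` … `θ` is the shift operator
  `θF(φ,ζ) = F(φ+ζ)`, and [B] `(E_C θ F)(φ) = E_C F(φ + ζ)` … We define [C]
  `Z_N(φ) = (E_C θ Z_0)(φ) = E_C Z_0(φ + ζ)`. Then `Z_N(0) = E_C Z_0`. It is a basic property of
  Gaussian integrals (see [BS-rg-norm]) that, given covariances `C', C''`, [D]
  `E_{C''+C'} θ F = (E_{C''} θ ∘ E_{C'} θ) F`. In terms of the decomposition [`C = Σ_{j<N} C_j +
  C_{N,N}`], this implies that [E] `E_C θ F = (E_{C_{N,N}} θ ∘ E_{C_{N-1}} θ ∘ ⋯ ∘ E_{C_1} θ) F`.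
  … if we set `Z_0 = e^{-V_0(Λ_N)}` … and define [F] `Z_{j+1} = E_{C_{j+1}} θ Z_j (j < N)`, then,
  consistent with [C], [G] `Z_N = E_C θ Z_0`."
* [H] (definition of `χ̂_N`, of `χ_N`, and the last display of §4.1):
  `χ̂_N(g,m²,ν_0) = n⁻¹ Σ_{x∈Λ_N} E_C((φ_0·φ_x)Z_0)/E_C Z_0`,
  `χ_N(g, ν_0 + m²) = χ̂_N(g, m², ν_0)`.

## What this file proves (everything; no named fact is introduced)

* Mathlib-generic: `multivariateGaussian_conv_multivariateGaussian` —
  **`N(μ₁,S₁) ∗ N(μ₂,S₂) = N(μ₁+μ₂,S₁+S₂)`** for positive semidefinite `S₁, S₂` (characteristic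
  functions), the "basic property of Gaussian integrals"; `volume_preserving_curry`
  (`ℝ^{Λ×κ} ≃ (ℝ^κ)^Λ` preserves Lebesgue measure); `tilted_eq_smul_withDensity`.
* `thetaConv P F φ = ∫ F(φ+ζ) dP(ζ)` — the operator `E_P θ` for any measure `P` — and
  **`thetaConv_conv`: `E_{μ∗ν} θ F = E_μ θ (E_ν θ F)`** wherever `F(φ + ·)` is integrable (Fubini),
  the abstract form of [D]; `progressive P F j` — the sequence [F].
* Field space `Λ → Fin n → ℝ` (`Λ` any finite set): `fieldEquiv` (from Euclidean `ℝ^{Λ×n}`,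
  additive, volume preserving), `componentMatrix C n = C ⊗ 1ₙ` (block diagonal; `mulVec`,
  quadratic form `Σ_i (vⁱ, Cvⁱ)`, additivity, products, inverse, positive (semi)definiteness),
  and **`fieldGaussian Λ C n` = `P_C`** := `N(0, C ⊗ 1ₙ)` transported to field space, for every
  positive semidefinite `C` (degenerate included): a probability measure, **centred with
  `E_C(φ_xⁱφ_yʲ) = δ_{ij}C_{xy}`** (`integral_eval_mul_eval_fieldGaussian`), `P_0 = δ_0`,
  **`P_{C₁+C₂} = P_{C₁} ∗ P_{C₂}`** (`fieldGaussian_add`), and **[D]**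
  `E_{C''+C'} θ F = E_{C''} θ (E_{C'} θ F)` (`thetaConv_fieldGaussian_add`, pointwise under
  integrability; `…_of_bounded` as functions for bounded measurable `F`).
* The density for `A = C⁻¹` positive definite ("proportional to `e^{-½ΣΣ φ C⁻¹ φ} Π dφ_x`"):
  `fieldGaussian_inv_eq_withDensity` / `fieldGaussian_inv_eq_tilted` (`P_C = e^{-½q_A}dφ/∫e^{-½q_A}`,
  `q_A = Σ_i (φⁱ, Aφⁱ)`, with `0 < ∫ e^{-½ q_A} < ∞`), `integral_fieldGaussian_inv`.
* **[E]/[G]** `progressive_fieldGaussian_eq`: for positive semidefinite `C_0,…,C_{N-1}` and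
  bounded measurable `F`, `(E_{C_{N-1}} θ ∘ ⋯ ∘ E_{C_0} θ)F = E_{ΣC_j} θ F`.
* The long-range model (`Λ = (ℤ/Mℤ)^d`, `C = ((-Δ_Λ)^{α/2}+m²)⁻¹ = (covInvMatrix d (α/2) M m²)⁻¹`,
  `m² > 0`, `d ≥ 1`, `α ∈ (0,2)`): `gaussianPC_eq_tilted` (`P_C = e^{-½(ζ,C⁻¹ζ)}dζ/∫…`),
  **[A]** `gibbsMeasure_eq_gaussianPC_tilted` (`e^{-V_{g,ν₀+m²}}dφ/Z = Z_0 dP_C/E_C Z_0`) and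
  `expect_eq_gaussianPC` (**`⟨F⟩_{g,ν₀+m²,N} = E_C(F Z_0)/E_C Z_0`**, every observable `F`);
  **[H]** `torusSusceptibility_eq_gaussianPC`; **[C]** `ZN` with `ZN_zero`
  (`Z_N(0) = E_C Z_0`), `ZN_pos`, `abs_ZN_le`, `gaussConvZ0_eq_mul_ZN` (the sibling file's
  unnormalised convolution is `(∫e^{-½(ζ,C⁻¹ζ)}dζ)·Z_N`), `integral_exp_neg_potential_eq`
  (`∫ e^{-V} = (∫ e^{-½(ζ,C⁻¹ζ)}) Z_N(0)`); and **[F]–[G]** `progressive_eq_ZN`: for ANY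
  decomposition of `C` into positive semidefinite pieces, progressive integration of
  `Z_0 = e^{-V_0}` (`g > 0`; `0 < Z_0 ≤ e^{|Λ|ν₀²/(4g)}`) ends at `Z_N = E_C θ Z_0`.

Not treated: the supersymmetric `n = 0` versions; the specific finite-range decomposition of §3
(`C = Σ_{j<N} C_j + C_{N,N}`, from [Baue13a] via Proposition 2.1.3), for which `progressive_eq_ZN`
is the statement [G] once the pieces are supplied. Ledger effect: none on the trust base of the
barrier's reduction chain (`Slade2017_prop822`); this is the Gaussian-integration layer on which
the RG map of §5–§6 acts.
-/

noncomputable section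

namespace Literature.Barriers.CriticalPhenomena

open _root_.MeasureTheory _root_.ProbabilityTheory Finset Filter Matrix
  Literature.Probability.LatticeModels Literature.MathematicalPhysics.QuantumFieldTheory
open scoped _root_.Topology BigOperators Matrix ENNReal MatrixOrder

namespace LongRangePhi4

/-! ### Sums of independent Gaussian vectors: `N(μ₁,S₁) ∗ N(μ₂,S₂) = N(μ₁+μ₂, S₁+S₂)` -/

section Generic

variable {ι : Type*} [Fintype ι] [DecidableEq ι]

/-- **Convolution of multivariate Gaussians**: for positive semidefinite `S₁, S₂`,
`N(μ₁,S₁) ∗ N(μ₂,S₂) = N(μ₁+μ₂, S₁+S₂)` on Euclidean `ℝ^ι` (the "basic property of Gaussian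
integrals" behind Slade's `E_{C''+C'}θ = E_{C''}θ ∘ E_{C'}θ`, via characteristic functions). [folklore] -/
theorem multivariateGaussian_conv_multivariateGaussian (μ₁ μ₂ : EuclideanSpace ℝ ι)
    {S₁ S₂ : Matrix ι ι ℝ} (h₁ : S₁.PosSemidef) (h₂ : S₂.PosSemidef) :
    multivariateGaussian μ₁ S₁ ∗ multivariateGaussian μ₂ S₂ =
      multivariateGaussian (μ₁ + μ₂) (S₁ + S₂) := by
  apply Measure.ext_of_charFun
  funext t
  rw [charFun_conv, charFun_multivariateGaussian h₁, charFun_multivariateGaussian h₂,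
    charFun_multivariateGaussian (h₁.add h₂), ← Complex.exp_add]
  congr 1
  rw [inner_add_right, Matrix.add_mulVec, dotProduct_add]
  push_cast
  ring

end Generic

/-! ### The convolution operator `E_P θ` and its semigroup property -/

section Theta

variable {X : Type*} [AddCommGroup X] [MeasurableSpace X]

/-- **The Gaussian convolution operator `E_C θ`** of Slade §4.1 — "`θ` is the shift operator
`θF(φ,ζ) = F(φ+ζ)`, and `(E_C θ F)(φ) = E_C F(φ+ζ)`, where the expectation `E_C` acts on `ζ` and
leaves `φ` fixed" — written for an arbitrary measure `P` in place of the Gaussian `P_C`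
(Bochner integral; `0` if `F(φ + ·)` is not `P`-integrable). [cite: Slade2017, §4.1 (definition of E_Cθ F)] -/
def thetaConv (P : Measure X) (F : X → ℝ) (φ : X) : ℝ := ∫ ζ, F (φ + ζ) ∂P

/-- Unfolding `E_P θ F`. [folklore] -/
theorem thetaConv_apply (P : Measure X) (F : X → ℝ) (φ : X) :
    thetaConv P F φ = ∫ ζ, F (φ + ζ) ∂P := rfl

/-- `(E_P θ F)(0) = E_P F` ("Then `Z_N(0) = E_C Z_0`"). [cite: Slade2017, §4.1 (definition of Z_N)] -/
theorem thetaConv_zero_left (P : Measure X) (F : X → ℝ) : thetaConv P F 0 = ∫ ζ, F ζ ∂P := by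
  simp [thetaConv]

/-- `E_{δ_0} θ F = F`. [folklore] -/
theorem thetaConv_dirac_zero [MeasurableSingletonClass X] (F : X → ℝ) :
    thetaConv (Measure.dirac (0 : X)) F = F := by
  funext φ
  rw [thetaConv, integral_dirac, add_zero]

variable [MeasurableAdd₂ X]

/-- **Progressive integration, abstract form of Slade's `E_{C''+C'}θF = (E_{C''}θ ∘ E_{C'}θ)F`**:
for measures `μ, ν` on an additive group, `E_{μ∗ν} θ F = E_μ θ (E_ν θ F)` at every `φ` at which
`F(φ + ·)` is `μ ∗ ν`-integrable (Fubini). [cite: Slade2017, §4.1 (display E_{C''+C'}θF = (E_{C''}θ ∘ E_{C'}θ)F)] -/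
theorem thetaConv_conv {μ ν : Measure X} [SFinite μ] [SFinite ν] (F : X → ℝ) (φ : X)
    (hF : Integrable (fun ζ => F (φ + ζ)) (μ ∗ ν)) :
    thetaConv (μ ∗ ν) F φ = thetaConv μ (thetaConv ν F) φ := by
  rw [thetaConv, integral_conv hF]
  simp only [thetaConv, add_assoc]

/-- A bounded measurable `F` has `F(φ + ·)` integrable for every finite measure. [folklore] -/
theorem integrable_comp_add_of_bounded {P : Measure X} [IsFiniteMeasure P] {F : X → ℝ}
    (hF : Measurable F) {B : ℝ} (hB : ∀ x, |F x| ≤ B) (φ : X) :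
    Integrable (fun ζ => F (φ + ζ)) P := by
  refine (integrable_const B).mono' (hF.comp (measurable_const_add φ)).aestronglyMeasurable
    (Eventually.of_forall fun ζ => ?_)
  rw [Real.norm_eq_abs]
  exact hB _

omit [MeasurableAdd₂ X] in
/-- `|E_P θ F| ≤ B` for a probability measure `P` and `|F| ≤ B`. [folklore] -/
theorem abs_thetaConv_le {P : Measure X} [IsProbabilityMeasure P] {F : X → ℝ} {B : ℝ}
    (hB : ∀ x, |F x| ≤ B) (φ : X) : |thetaConv P F φ| ≤ B := by
  rw [thetaConv]
  have h0 : 0 ≤ B := (abs_nonneg _).trans (hB 0)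
  calc |∫ ζ, F (φ + ζ) ∂P| ≤ ∫ ζ, |F (φ + ζ)| ∂P := abs_integral_le_integral_abs
    _ ≤ ∫ _ζ, B ∂P := by
        by_cases hi : Integrable (fun ζ => |F (φ + ζ)|) P
        · exact integral_mono hi (integrable_const B) fun ζ => hB _
        · rw [integral_undef hi]; exact integral_nonneg fun _ => h0
    _ = B := by simp

end Theta

/-! ### Lebesgue measure and currying: `ℝ^{Λ × κ} ≃ (ℝ^κ)^Λ` -/

section Curry

variable (Λ κ : Type*) [Fintype Λ] [Fintype κ]

/-- **Uncurrying preserves Lebesgue measure**: `(Λ → κ → ℝ) → (Λ × κ → ℝ)` is measure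
preserving for the product Lebesgue measures. [folklore] -/
theorem volume_preserving_curry_symm :
    MeasurePreserving (MeasurableEquiv.curry Λ κ ℝ).symm
      (volume : Measure (Λ → κ → ℝ)) (volume : Measure (Λ × κ → ℝ)) where
  measurable := (MeasurableEquiv.curry Λ κ ℝ).symm.measurable
  map_eq := by
    rw [volume_pi]
    refine (Measure.pi_eq fun s hs => ?_).symm
    rw [MeasurableEquiv.map_apply, MeasurableEquiv.coe_curry_symm]
    have hpre : Function.uncurry ⁻¹' Set.univ.pi s =
        Set.univ.pi fun x : Λ => Set.univ.pi fun i : κ => s (x, i) := by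
      ext f
      simp only [Set.mem_preimage, Set.mem_univ_pi, Function.uncurry_apply_pair, Prod.forall]
    rw [hpre, Measure.pi_pi]
    simp_rw [volume_pi_pi]
    rw [← Finset.univ_product_univ, Finset.prod_product]

/-- **Currying preserves Lebesgue measure**: `(Λ × κ → ℝ) → (Λ → κ → ℝ)`. [folklore] -/
theorem volume_preserving_curry :
    MeasurePreserving (MeasurableEquiv.curry Λ κ ℝ)
      (volume : Measure (Λ × κ → ℝ)) (volume : Measure (Λ → κ → ℝ)) :=
  (volume_preserving_curry_symm Λ κ).symm _

end Curry

/-! ### Field space `(ℝⁿ)^Λ`, the matrix `C ⊗ 1ₙ` and the Gaussian measure `P_C` -/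

section FieldSpace

variable (Λ : Type*) (n : ℕ)

/-- Euclidean `ℝ^{Λ × n}` identified with field space `(ℝⁿ)^Λ = Λ → Fin n → ℝ`
(`y ↦ (x ↦ i ↦ y_{(x,i)})`), as a measurable equivalence. [folklore] -/
def fieldEquiv : EuclideanSpace ℝ (Λ × Fin n) ≃ᵐ (Λ → Fin n → ℝ) :=
  (MeasurableEquiv.toLp 2 (Λ × Fin n → ℝ)).symm.trans (MeasurableEquiv.curry Λ (Fin n) ℝ)

variable {Λ n}

/-- `fieldEquiv y x i = y_{(x,i)}`. [folklore] -/
@[simp] theorem fieldEquiv_apply (y : EuclideanSpace ℝ (Λ × Fin n)) (x : Λ) (i : Fin n) :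
    fieldEquiv Λ n y x i = y (x, i) := rfl

/-- `fieldEquiv⁻¹ φ (x,i) = φ_xⁱ`. [folklore] -/
@[simp] theorem fieldEquiv_symm_apply (φ : Λ → Fin n → ℝ) (p : Λ × Fin n) :
    (fieldEquiv Λ n).symm φ p = φ p.1 p.2 := rfl

/-- The coordinates of `fieldEquiv⁻¹ φ`. [folklore] -/
theorem ofLp_fieldEquiv_symm (φ : Λ → Fin n → ℝ) :
    WithLp.ofLp ((fieldEquiv Λ n).symm φ) = fun p => φ p.1 p.2 := rfl

/-- `fieldEquiv 0 = 0`. [folklore] -/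
@[simp] theorem fieldEquiv_zero : fieldEquiv Λ n 0 = 0 := rfl

/-- `fieldEquiv` is additive. [folklore] -/
theorem fieldEquiv_add (y y' : EuclideanSpace ℝ (Λ × Fin n)) :
    fieldEquiv Λ n (y + y') = fieldEquiv Λ n y + fieldEquiv Λ n y' := rfl

variable (Λ n) in
/-- `fieldEquiv` as an additive homomorphism. [folklore] -/
def fieldEquivAddHom : EuclideanSpace ℝ (Λ × Fin n) →+ (Λ → Fin n → ℝ) where
  toFun := fieldEquiv Λ n
  map_zero' := rfl
  map_add' := fieldEquiv_add

/-- The additive homomorphism is `fieldEquiv`. [folklore] -/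
@[simp] theorem coe_fieldEquivAddHom : ⇑(fieldEquivAddHom Λ n) = fieldEquiv Λ n := rfl

/-- **The matrix `C ⊗ 1ₙ` on `ℝ^{Λ × n}`**: a `Λ × Λ` matrix `C` acting in the same way on each of
the `n` components (Slade §4.1: `P_C` "is proportional to
`e^{-½ Σ_{i=1}^n Σ_{x,y∈Λ} φ_xⁱ C⁻¹_{xy} φ_yⁱ}`", i.e. the `n` components are i.i.d. with
covariance `C`). [cite: Slade2017, §4.1 (Gaussian measure P_C)] -/
def componentMatrix (C : Matrix Λ Λ ℝ) (n : ℕ) : Matrix (Λ × Fin n) (Λ × Fin n) ℝ :=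
  Matrix.blockDiagonal fun _ : Fin n => C

/-- Entries of `C ⊗ 1ₙ`: `δ_{ij} C_{xy}`. [folklore] -/
theorem componentMatrix_apply (C : Matrix Λ Λ ℝ) (p q : Λ × Fin n) :
    componentMatrix C n p q = if p.2 = q.2 then C p.1 q.1 else 0 := by
  rw [componentMatrix, Matrix.blockDiagonal_apply]

/-- `(C₁ + C₂) ⊗ 1ₙ = C₁ ⊗ 1ₙ + C₂ ⊗ 1ₙ`. [folklore] -/
theorem componentMatrix_add (C₁ C₂ : Matrix Λ Λ ℝ) :
    componentMatrix (C₁ + C₂) n = componentMatrix C₁ n + componentMatrix C₂ n :=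
  Matrix.blockDiagonal_add _ _

/-- `0 ⊗ 1ₙ = 0`. [folklore] -/
@[simp] theorem componentMatrix_zero : componentMatrix (0 : Matrix Λ Λ ℝ) n = 0 :=
  Matrix.blockDiagonal_zero

/-- `(Σ_k C_k) ⊗ 1ₙ = Σ_k (C_k ⊗ 1ₙ)`. [folklore] -/
theorem componentMatrix_sum {κ : Type*} (s : Finset κ) (C : κ → Matrix Λ Λ ℝ) :
    componentMatrix (∑ k ∈ s, C k) n = ∑ k ∈ s, componentMatrix (C k) n := by
  induction s using Finset.cons_induction with
  | empty => simp
  | cons a s ha ih => rw [Finset.sum_cons, Finset.sum_cons, componentMatrix_add, ih]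

/-- `C ⊗ 1ₙ` is symmetric when `C` is. [folklore] -/
theorem isHermitian_componentMatrix {C : Matrix Λ Λ ℝ} (hC : C.IsHermitian) :
    (componentMatrix C n).IsHermitian :=
  Matrix.isHermitian_blockDiagonal_iff.2 fun _ => hC

/-- `1 ⊗ 1ₙ = 1`. [folklore] -/
@[simp] theorem componentMatrix_one [DecidableEq Λ] : componentMatrix (1 : Matrix Λ Λ ℝ) n = 1 :=
  Matrix.blockDiagonal_one

variable [Fintype Λ]

variable (Λ n) in
/-- **`fieldEquiv` preserves Lebesgue measure.** [folklore] -/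
theorem volume_preserving_fieldEquiv :
    MeasurePreserving (fieldEquiv Λ n) (volume : Measure (EuclideanSpace ℝ (Λ × Fin n))) volume :=
  (volume_preserving_curry Λ (Fin n)).comp (PiLp.volume_preserving_ofLp (Λ × Fin n))

variable (Λ n) in
/-- Its inverse preserves Lebesgue measure. [folklore] -/
theorem volume_preserving_fieldEquiv_symm :
    MeasurePreserving (fieldEquiv Λ n).symm (volume : Measure (Λ → Fin n → ℝ)) volume :=
  (volume_preserving_fieldEquiv Λ n).symm _

/-- `C ⊗ 1ₙ` acts componentwise: `((C ⊗ 1ₙ)v)_{(x,i)} = Σ_y C_{xy} v_{(y,i)}`. [folklore] -/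
theorem componentMatrix_mulVec (C : Matrix Λ Λ ℝ) (v : Λ × Fin n → ℝ) (p : Λ × Fin n) :
    (componentMatrix C n *ᵥ v) p = ∑ y, C p.1 y * v (y, p.2) := by
  rw [Matrix.mulVec, dotProduct, ← Finset.univ_product_univ, Finset.sum_product]
  refine Finset.sum_congr rfl fun y _ => ?_
  simp only [componentMatrix_apply]
  rw [Finset.sum_eq_single p.2 (fun j _ hj => by rw [if_neg (Ne.symm hj), zero_mul])
    (fun h => (h (Finset.mem_univ _)).elim), if_pos rfl]

/-- The quadratic form of `C ⊗ 1ₙ` is the sum over components of the quadratic form of `C`: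
`w ⬝ (C ⊗ 1ₙ)v = Σ_i wⁱ ⬝ C vⁱ`. [cite: Slade2017, §4.1 (Gaussian measure P_C)] -/
theorem dotProduct_componentMatrix_mulVec (C : Matrix Λ Λ ℝ) (v w : Λ × Fin n → ℝ) :
    w ⬝ᵥ (componentMatrix C n *ᵥ v) = ∑ i, (fun x => w (x, i)) ⬝ᵥ (C *ᵥ fun x => v (x, i)) := by
  simp only [dotProduct, componentMatrix_mulVec]
  simp only [Matrix.mulVec, dotProduct]
  rw [← Finset.univ_product_univ, Finset.sum_product_right]

/-- `(C₁C₂) ⊗ 1ₙ = (C₁ ⊗ 1ₙ)(C₂ ⊗ 1ₙ)`. [folklore] -/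
theorem componentMatrix_mul (C₁ C₂ : Matrix Λ Λ ℝ) :
    componentMatrix (C₁ * C₂) n = componentMatrix C₁ n * componentMatrix C₂ n :=
  Matrix.blockDiagonal_mul _ _

/-- `C ⊗ 1ₙ` is positive semidefinite when `C` is. [folklore] -/
theorem posSemidef_componentMatrix {C : Matrix Λ Λ ℝ} (hC : C.PosSemidef) :
    (componentMatrix C n).PosSemidef := by
  refine Matrix.PosSemidef.of_dotProduct_mulVec_nonneg (isHermitian_componentMatrix hC.isHermitian)
    fun v => ?_
  rw [star_trivial, dotProduct_componentMatrix_mulVec]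
  exact Finset.sum_nonneg fun i _ => by
    simpa only [star_trivial] using hC.dotProduct_mulVec_nonneg fun x => v (x, i)

/-- `C ⊗ 1ₙ` is positive definite when `C` is. [folklore] -/
theorem posDef_componentMatrix {C : Matrix Λ Λ ℝ} (hC : C.PosDef) :
    (componentMatrix C n).PosDef := by
  refine Matrix.PosDef.of_dotProduct_mulVec_pos (isHermitian_componentMatrix hC.isHermitian)
    fun v hv => ?_
  rw [star_trivial, dotProduct_componentMatrix_mulVec]
  obtain ⟨⟨x₀, i₀⟩, h₀⟩ : ∃ p, v p ≠ 0 := by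
    by_contra hall
    push Not at hall
    exact hv (funext hall)
  have hnn : ∀ i, 0 ≤ (fun x => v (x, i)) ⬝ᵥ (C *ᵥ fun x => v (x, i)) := fun i => by
    simpa only [star_trivial] using hC.posSemidef.dotProduct_mulVec_nonneg fun x => v (x, i)
  have hpos : 0 < (fun x => v (x, i₀)) ⬝ᵥ (C *ᵥ fun x => v (x, i₀)) := by
    have hne : (fun x => v (x, i₀)) ≠ 0 := fun h => h₀ (congrFun h x₀)
    simpa only [star_trivial] using hC.dotProduct_mulVec_pos hne
  exact lt_of_lt_of_le hpos (Finset.single_le_sum (fun i _ => hnn i) (Finset.mem_univ i₀))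

variable [DecidableEq Λ]

/-- `(C ⊗ 1ₙ)⁻¹ = C⁻¹ ⊗ 1ₙ` for invertible `C`. [folklore] -/
theorem componentMatrix_inv {C : Matrix Λ Λ ℝ} (hC : IsUnit C) :
    (componentMatrix C n)⁻¹ = componentMatrix C⁻¹ n := by
  refine Matrix.inv_eq_right_inv ?_
  rw [← componentMatrix_mul, Matrix.mul_nonsing_inv _ ((Matrix.isUnit_iff_isUnit_det _).1 hC),
    componentMatrix_one]

variable (Λ) in
/-- **The Gaussian measure `P_C` on field space `(ℝⁿ)^Λ`** (Slade §4.1: "given a `Λ × Λ`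
covariance matrix `C`, let `P_C` denote the Gaussian probability measure on `(ℝⁿ)^Λ` with
covariance `C`. This means that `P_C` is proportional to
`e^{-½ Σ_{i=1}^n Σ_{x,y∈Λ} φ_xⁱ C⁻¹_{xy} φ_yⁱ} Π_{x∈Λ} dφ_x` (properly interpreted when `C` is only
positive semi-definite rather than positive-definite)"): Mathlib's centred multivariate Gaussian
`N(0, C ⊗ 1ₙ)` on Euclidean `ℝ^{Λ×n}` — defined for every positive semidefinite `C`, degenerate
ones included — transported to `Λ → Fin n → ℝ`. [cite: Slade2017, §4.1 (Gaussian measure P_C)] -/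
def fieldGaussian (C : Matrix Λ Λ ℝ) (n : ℕ) : Measure (Λ → Fin n → ℝ) :=
  (multivariateGaussian 0 (componentMatrix C n)).map (fieldEquiv Λ n)

/-- `P_C` is a probability measure. [cite: Slade2017, §4.1 (Gaussian measure P_C)] -/
instance isProbabilityMeasure_fieldGaussian (C : Matrix Λ Λ ℝ) :
    IsProbabilityMeasure (fieldGaussian Λ C n) :=
  Measure.isProbabilityMeasure_map (fieldEquiv Λ n).measurable.aemeasurable

/-- `E_C G = ∫ G(fieldEquiv y) dN(0, C ⊗ 1ₙ)(y)`. [folklore] -/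
theorem integral_fieldGaussian (C : Matrix Λ Λ ℝ) (G : (Λ → Fin n → ℝ) → ℝ) :
    ∫ φ, G φ ∂(fieldGaussian Λ C n) =
      ∫ y, G (fieldEquiv Λ n y) ∂(multivariateGaussian 0 (componentMatrix C n)) := by
  rw [fieldGaussian, integral_map_equiv]

/-- **`P_{C₁+C₂} = P_{C₁} ∗ P_{C₂}`** on field space, for positive semidefinite `C₁, C₂` — the
measure form of "the basic property of Gaussian integrals" `E_{C''+C'}θ = E_{C''}θ ∘ E_{C'}θ`.
[cite: Slade2017, §4.1 (display E_{C''+C'}θF = (E_{C''}θ ∘ E_{C'}θ)F)] -/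
theorem fieldGaussian_add {C₁ C₂ : Matrix Λ Λ ℝ} (h₁ : C₁.PosSemidef) (h₂ : C₂.PosSemidef) :
    fieldGaussian Λ (C₁ + C₂) n = fieldGaussian Λ C₁ n ∗ fieldGaussian Λ C₂ n := by
  have h := Measure.map_conv_addMonoidHom (μ := multivariateGaussian 0 (componentMatrix C₁ n))
    (ν := multivariateGaussian 0 (componentMatrix C₂ n)) (fieldEquivAddHom Λ n)
    (by rw [coe_fieldEquivAddHom]; exact (fieldEquiv Λ n).measurable)
  rw [coe_fieldEquivAddHom, multivariateGaussian_conv_multivariateGaussian 0 0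
    (posSemidef_componentMatrix h₁) (posSemidef_componentMatrix h₂), add_zero,
    ← componentMatrix_add] at h
  exact h

/-- The degenerate Gaussian `P_0` is the point mass at the zero field. [folklore] -/
theorem fieldGaussian_zero : fieldGaussian Λ (0 : Matrix Λ Λ ℝ) n = Measure.dirac 0 := by
  rw [fieldGaussian, componentMatrix_zero, multivariateGaussian,
    Measure.map_map (fieldEquiv Λ n).measurable (by fun_prop)]
  have h : (fieldEquiv Λ n ∘ fun x : EuclideanSpace ℝ (Λ × Fin n) =>
      (0 : EuclideanSpace ℝ (Λ × Fin n)) + toEuclideanCLM (𝕜 := ℝ) (CFC.sqrt (0 : Matrix _ _ ℝ)) x) =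
      fun _ => 0 := by
    funext x
    rw [Function.comp_apply, CFC.sqrt_zero, map_zero, _root_.zero_apply, add_zero, fieldEquiv_zero]
  rw [h, Measure.map_const, measure_univ, one_smul]

/-- **`P_C` is centred**: `E_C φ_xⁱ = 0`. [cite: Slade2017, §4.1 (Gaussian measure P_C)] -/
theorem integral_eval_fieldGaussian (C : Matrix Λ Λ ℝ) (x : Λ) (i : Fin n) :
    ∫ φ, φ x i ∂(fieldGaussian Λ C n) = 0 := by
  rw [integral_fieldGaussian]
  simp only [fieldEquiv_apply]
  have h := IsGaussian.integral_dual (μ := multivariateGaussian (0 : EuclideanSpace ℝ (Λ × Fin n))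
    (componentMatrix C n)) (EuclideanSpace.proj (𝕜 := ℝ) (x, i))
  rw [integral_id_multivariateGaussian, map_zero] at h
  simpa [EuclideanSpace.coe_proj] using h

/-- **`P_C` has covariance `C` in each component, the components being uncorrelated**:
`E_C (φ_xⁱ φ_yʲ) = δ_{ij} C_{xy}` for positive semidefinite `C` ("the Gaussian probability measure
on `(ℝⁿ)^Λ` with covariance `C`"). [cite: Slade2017, §4.1 (Gaussian measure P_C)] -/
theorem integral_eval_mul_eval_fieldGaussian {C : Matrix Λ Λ ℝ} (hC : C.PosSemidef) (x y : Λ)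
    (i j : Fin n) :
    ∫ φ, φ x i * φ y j ∂(fieldGaussian Λ C n) = if i = j then C x y else 0 := by
  rw [integral_fieldGaussian]
  simp only [fieldEquiv_apply]
  set μ := multivariateGaussian (0 : EuclideanSpace ℝ (Λ × Fin n)) (componentMatrix C n) with hμ
  have hmem : ∀ p : Λ × Fin n, MemLp (fun z : EuclideanSpace ℝ (Λ × Fin n) => z p) 2 μ := fun p => by
    have h := IsGaussian.memLp_dual μ (EuclideanSpace.proj (𝕜 := ℝ) p) 2 (by simp)
    simpa [EuclideanSpace.coe_proj] using h
  have hmean : ∀ p : Λ × Fin n, ∫ z : EuclideanSpace ℝ (Λ × Fin n), z p ∂μ = 0 := fun p => by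
    have h := IsGaussian.integral_dual (μ := μ) (EuclideanSpace.proj (𝕜 := ℝ) p)
    rw [hμ, integral_id_multivariateGaussian, map_zero] at h
    simpa [EuclideanSpace.coe_proj] using h
  have hcov := covariance_eval_multivariateGaussian (μ := (0 : EuclideanSpace ℝ (Λ × Fin n)))
    (posSemidef_componentMatrix (n := n) hC) (x, i) (y, j)
  rw [← hμ, covariance_eq_sub (hmem _) (hmem _), hmean, hmean, mul_zero, sub_zero,
    componentMatrix_apply] at hcov
  simpa only [Pi.mul_apply] using hcov

/-- **Progressive integration `E_{C''+C'}θ = E_{C''}θ ∘ E_{C'}θ` on field space**: for positive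
semidefinite `C', C''` and every
`φ` at which `F(φ + ·)` is `P_{C''+C'}`-integrable,
`(E_{C''+C'} θ F)(φ) = (E_{C''} θ (E_{C'} θ F))(φ)`.
[cite: Slade2017, §4.1 (display E_{C''+C'}θF = (E_{C''}θ ∘ E_{C'}θ)F)] -/
theorem thetaConv_fieldGaussian_add {C' C'' : Matrix Λ Λ ℝ} (h' : C'.PosSemidef)
    (h'' : C''.PosSemidef) (F : (Λ → Fin n → ℝ) → ℝ) (φ : Λ → Fin n → ℝ)
    (hF : Integrable (fun ζ => F (φ + ζ)) (fieldGaussian Λ (C'' + C') n)) :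
    thetaConv (fieldGaussian Λ (C'' + C') n) F φ =
      thetaConv (fieldGaussian Λ C'' n) (thetaConv (fieldGaussian Λ C' n) F) φ := by
  rw [fieldGaussian_add h'' h'] at hF ⊢
  exact thetaConv_conv F φ hF

/-- **Progressive integration**, `E_{C''+C'} θ F = E_{C''} θ ∘ E_{C'} θ F` as functions, for
bounded measurable `F` and positive semidefinite `C', C''`.
[cite: Slade2017, §4.1 (display E_{C''+C'}θF = (E_{C''}θ ∘ E_{C'}θ)F)] -/
theorem thetaConv_fieldGaussian_add_of_bounded {C' C'' : Matrix Λ Λ ℝ} (h' : C'.PosSemidef)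
    (h'' : C''.PosSemidef) {F : (Λ → Fin n → ℝ) → ℝ} (hF : Measurable F) {B : ℝ}
    (hB : ∀ φ, |F φ| ≤ B) :
    thetaConv (fieldGaussian Λ (C'' + C') n) F =
      thetaConv (fieldGaussian Λ C'' n) (thetaConv (fieldGaussian Λ C' n) F) :=
  funext fun φ => thetaConv_fieldGaussian_add h' h'' F φ (integrable_comp_add_of_bounded hF hB φ)

end FieldSpace

/-! ### Exponential tilts with an integrable weight -/

section Tilt

variable {Ω : Type*} [MeasurableSpace Ω]

/-- A tilt by an integrable exponential weight is the normalised measure with density: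
`μ.tilted f = (∫⁻ e^f dμ)⁻¹ • e^f μ`. [folklore] -/
theorem tilted_eq_smul_withDensity (μ : Measure Ω) {f : Ω → ℝ} (hf : Measurable f)
    (hint : Integrable (fun x => Real.exp (f x)) μ) :
    μ.tilted f = (∫⁻ x, ENNReal.ofReal (Real.exp (f x)) ∂μ)⁻¹ •
      μ.withDensity fun x => ENNReal.ofReal (Real.exp (f x)) := by
  rcases eq_zero_or_neZero μ with rfl | hμ
  · simp
  have hpos : 0 < ∫ x, Real.exp (f x) ∂μ := integral_exp_pos hint
  have hZ : ENNReal.ofReal (∫ x, Real.exp (f x) ∂μ) = ∫⁻ x, ENNReal.ofReal (Real.exp (f x)) ∂μ :=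
    ofReal_integral_eq_lintegral_ofReal hint (Eventually.of_forall fun x => (Real.exp_pos _).le)
  unfold Measure.tilted
  rw [← hZ]
  have h : (fun x => ENNReal.ofReal (Real.exp (f x) / ∫ x, Real.exp (f x) ∂μ)) =
      (ENNReal.ofReal (∫ x, Real.exp (f x) ∂μ))⁻¹ • fun x => ENNReal.ofReal (Real.exp (f x)) := by
    funext x
    rw [Pi.smul_apply, smul_eq_mul, ENNReal.ofReal_div_of_pos hpos, ENNReal.div_eq_inv_mul]
  rw [h]
  exact withDensity_smul _ hf.exp.ennreal_ofReal

end Tilt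

/-! ### `P_C` for positive definite `C⁻¹`: the density `e^{-½ Σ_i (φⁱ, C⁻¹ φⁱ)}` -/

section Density

variable {Λ : Type*} {n : ℕ}

/-- The quadratic form of `A ⊗ 1ₙ` on field space: `q_A(φ) = Σ_{i=1}^n (φⁱ, A φⁱ) =
Σ_i Σ_{x,y∈Λ} φ_xⁱ A_{xy} φ_yⁱ` (the exponent of `P_C` is `-½ q_{C⁻¹}`).
[cite: Slade2017, §4.1 (Gaussian measure P_C)] -/
def compForm [Fintype Λ] (A : Matrix Λ Λ ℝ) (φ : Λ → Fin n → ℝ) : ℝ :=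
  ∑ i, (fun x => φ x i) ⬝ᵥ (A *ᵥ fun x => φ x i)

variable [Fintype Λ]

/-- `q_A` is the quadratic form of `A ⊗ 1ₙ`. [folklore] -/
theorem compForm_eq_dotProduct (A : Matrix Λ Λ ℝ) (φ : Λ → Fin n → ℝ) :
    compForm A φ = (fun p : Λ × Fin n => φ p.1 p.2) ⬝ᵥ
      (componentMatrix A n *ᵥ fun p : Λ × Fin n => φ p.1 p.2) := by
  rw [dotProduct_componentMatrix_mulVec]; rfl

/-- `q_A` is a continuous function of the field. [folklore] -/
@[fun_prop]
theorem continuous_compForm (A : Matrix Λ Λ ℝ) : Continuous (compForm (n := n) A) := by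
  unfold compForm dotProduct Matrix.mulVec
  fun_prop

/-- `q_A` is measurable. [folklore] -/
@[fun_prop]
theorem measurable_compForm (A : Matrix Λ Λ ℝ) : Measurable (compForm (n := n) A) :=
  (continuous_compForm A).measurable

/-- The `GaussianToolkit` weight of `A ⊗ 1ₙ` along `fieldEquiv` is `e^{-½ q_A}`. [folklore] -/
theorem gaussWeight_componentMatrix_fieldEquiv_symm (A : Matrix Λ Λ ℝ) (φ : Λ → Fin n → ℝ) :
    GaussianToolkit.gaussWeight (componentMatrix A n) ((fieldEquiv Λ n).symm φ) =
      ENNReal.ofReal (Real.exp (-(compForm A φ) / 2)) := by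
  rw [GaussianToolkit.gaussWeight, ofLp_fieldEquiv_symm, compForm_eq_dotProduct]

/-- `Z_{A ⊗ 1ₙ} = ∫ e^{-½ q_A(φ)} dφ` over field space. [folklore] -/
theorem gaussZ_componentMatrix (A : Matrix Λ Λ ℝ) :
    GaussianToolkit.gaussZ (componentMatrix A n) =
      ∫⁻ φ : Λ → Fin n → ℝ, ENNReal.ofReal (Real.exp (-(compForm A φ) / 2)) := by
  rw [GaussianToolkit.gaussZ, ← (volume_preserving_fieldEquiv_symm Λ n).lintegral_comp
    (GaussianToolkit.measurable_gaussWeight _)]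
  simp_rw [gaussWeight_componentMatrix_fieldEquiv_symm]

variable [DecidableEq Λ]

/-- **`P_C` has density `Z⁻¹ e^{-½ Σ_i (φⁱ, C⁻¹φⁱ)}` with respect to Lebesgue measure `Π_x dφ_x`**
when `A = C⁻¹` is positive definite ("`P_C` is proportional to
`e^{-½ Σ_{i=1}^n Σ_{x,y∈Λ} φ_xⁱ C⁻¹_{xy} φ_yⁱ} Π_{x∈Λ} dφ_x`"), with `Z = ∫ e^{-½ q_A} ∈ (0,∞)`.
[cite: Slade2017, §4.1 (Gaussian measure P_C)] -/
theorem fieldGaussian_inv_eq_withDensity {A : Matrix Λ Λ ℝ} (hA : A.PosDef) :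
    fieldGaussian Λ A⁻¹ n =
      (∫⁻ φ : Λ → Fin n → ℝ, ENNReal.ofReal (Real.exp (-(compForm A φ) / 2)))⁻¹ •
        (volume : Measure (Λ → Fin n → ℝ)).withDensity
          (fun φ => ENNReal.ofReal (Real.exp (-(compForm A φ) / 2))) ∧
    (∫⁻ φ : Λ → Fin n → ℝ, ENNReal.ofReal (Real.exp (-(compForm A φ) / 2))) ≠ 0 ∧
    (∫⁻ φ : Λ → Fin n → ℝ, ENNReal.ofReal (Real.exp (-(compForm A φ) / 2))) ≠ ∞ := by
  have hP : (componentMatrix A n).PosDef := posDef_componentMatrix hA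
  obtain ⟨hρ, hZ0, hZtop⟩ := GaussianToolkit.multivariateGaussian_inv_eq_withDensity hP
  rw [gaussZ_componentMatrix] at hρ hZ0 hZtop
  refine ⟨?_, hZ0, hZtop⟩
  rw [fieldGaussian, ← componentMatrix_inv hA.isUnit, hρ, Measure.map_smul,
    GaussianToolkit.map_withDensity_equiv, (volume_preserving_fieldEquiv Λ n).map_eq]
  congr 2
  funext φ
  exact gaussWeight_componentMatrix_fieldEquiv_symm A φ

/-- **The Gaussian weight is integrable**: `∫ e^{-½ Σ_i (φⁱ, Aφⁱ)} dφ < ∞` for positive definite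
`A`. [folklore] -/
theorem integrable_exp_neg_compForm {A : Matrix Λ Λ ℝ} (hA : A.PosDef) :
    Integrable (fun φ : Λ → Fin n → ℝ => Real.exp (-(compForm A φ) / 2)) := by
  have h := (fieldGaussian_inv_eq_withDensity (n := n) hA).2.2
  exact (lintegral_ofReal_ne_top_iff_integrable
    (by fun_prop : Measurable fun φ : Λ → Fin n → ℝ =>
      Real.exp (-(compForm A φ) / 2)).aestronglyMeasurable
    (Eventually.of_forall fun φ => (Real.exp_pos _).le)).1 h

/-- **`P_C` is Lebesgue measure tilted by `-½ Σ_i (φⁱ, C⁻¹φⁱ)`** (`A = C⁻¹` positive definite):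
`P_C = e^{-½ q_A} dφ / ∫ e^{-½ q_A} dφ`. [cite: Slade2017, §4.1 (Gaussian measure P_C)] -/
theorem fieldGaussian_inv_eq_tilted {A : Matrix Λ Λ ℝ} (hA : A.PosDef) :
    fieldGaussian Λ A⁻¹ n =
      (volume : Measure (Λ → Fin n → ℝ)).tilted fun φ => -(compForm A φ) / 2 := by
  rw [(fieldGaussian_inv_eq_withDensity hA).1, tilted_eq_smul_withDensity _
    (by fun_prop : Measurable fun φ : Λ → Fin n → ℝ => -(compForm A φ) / 2)
    (integrable_exp_neg_compForm hA)]

/-- Integration against `P_C`, `A = C⁻¹` positive definite: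
`E_C G = ∫ e^{-½ q_A} G dφ / ∫ e^{-½ q_A} dφ`. [cite: Slade2017, §4.1 (Gaussian measure P_C)] -/
theorem integral_fieldGaussian_inv {A : Matrix Λ Λ ℝ} (hA : A.PosDef) (G : (Λ → Fin n → ℝ) → ℝ) :
    ∫ φ, G φ ∂(fieldGaussian Λ A⁻¹ n) =
      (∫ φ, Real.exp (-(compForm A φ) / 2) * G φ) /
        ∫ φ : Λ → Fin n → ℝ, Real.exp (-(compForm A φ) / 2) := by
  rw [fieldGaussian_inv_eq_tilted hA, integral_tilted]
  simp_rw [smul_eq_mul, div_mul_eq_mul_div]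
  rw [integral_div]

end Density

/-! ### Progressive integration over a covariance decomposition: `Z_{j+1} = E_{C_{j+1}}θZ_j`, `Z_N = E_CθZ_0` -/

section Progressive

variable {X : Type*} [AddCommGroup X] [MeasurableSpace X]

/-- **Progressive integration** (Slade's `Z_{j+1} = E_{C_{j+1}} θ Z_j`): given the measures
`P_0, P_1, …` of a covariance
decomposition and `Z_0 = F`, the sequence `Z_{j+1} = E_{P_j} θ Z_j` (the paper numbers the
covariances from `1`: its `C_{j+1}` is `P j` here).
[cite: Slade2017, §4.1 (display Z_{j+1} = E_{C_{j+1}}θZ_j (j < N))] -/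
def progressive (P : ℕ → Measure X) (F : X → ℝ) : ℕ → X → ℝ
  | 0 => F
  | j + 1 => thetaConv (P j) (progressive P F j)

/-- `Z_0 = F`. [folklore] -/
@[simp] theorem progressive_zero (P : ℕ → Measure X) (F : X → ℝ) : progressive P F 0 = F := rfl

/-- `Z_{j+1} = E_{P_j} θ Z_j`. [cite: Slade2017, §4.1 (display Z_{j+1} = E_{C_{j+1}}θZ_j (j < N))] -/
theorem progressive_succ (P : ℕ → Measure X) (F : X → ℝ) (j : ℕ) :
    progressive P F (j + 1) = thetaConv (P j) (progressive P F j) := rfl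

variable {Λ : Type*} [Fintype Λ] [DecidableEq Λ] {n : ℕ}

/-- **Progressive integration reproduces the full Gaussian integral** (Slade's
`E_CθF = (E_{C_{N,N}}θ ∘ ⋯ ∘ E_{C_1}θ)F` and `Z_N = E_CθZ_0`). For a
decomposition into positive semidefinite `Λ × Λ` matrices `C_0, …, C_{N-1}` and a bounded
measurable `F` on field space,
`(E_{C_{N-1}} θ ∘ ⋯ ∘ E_{C_1} θ ∘ E_{C_0} θ) F = E_{C_0 + ⋯ + C_{N-1}} θ F`; in particular
`Z_N = E_C θ Z_0` for `C = Σ_j C_j` ("then, consistent with [the definition of `Z_N`],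
`Z_N = E_C θ Z_0`").
[cite: Slade2017, §4.1 (displays E_CθF = (E_{C_{N,N}}θ∘⋯∘E_{C_1}θ)F and Z_N = E_CθZ_0)] -/
theorem progressive_fieldGaussian_eq {C : ℕ → Matrix Λ Λ ℝ} {N : ℕ}
    (hC : ∀ j < N, (C j).PosSemidef) {F : (Λ → Fin n → ℝ) → ℝ} (hF : Measurable F) {B : ℝ}
    (hB : ∀ φ, |F φ| ≤ B) :
    progressive (fun j => fieldGaussian Λ (C j) n) F N =
      thetaConv (fieldGaussian Λ (∑ j ∈ Finset.range N, C j) n) F := by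
  induction N with
  | zero => rw [progressive_zero, Finset.sum_range_zero, fieldGaussian_zero, thetaConv_dirac_zero]
  | succ N ih =>
    have hS : (∑ j ∈ Finset.range N, C j).PosSemidef :=
      Matrix.posSemidef_sum _ fun j hj => hC j ((Finset.mem_range.1 hj).trans N.lt_succ_self)
    rw [progressive_succ, ih fun j hj => hC j (hj.trans N.lt_succ_self), Finset.sum_range_succ,
      add_comm, thetaConv_fieldGaussian_add_of_bounded hS (hC N N.lt_succ_self) hF hB]

end Progressive

/-! ### The long-range model: `⟨F⟩_{g,ν,N} = E_C(F Z_0)/E_C Z_0` and `Z_N = E_C θ Z_0` (§4.1) -/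

section Model

variable {d M n : ℕ}

/-- **`P_C` of the long-range model**: the Gaussian measure on `(ℝⁿ)^Λ`, `Λ = (ℤ/Mℤ)^d`, with
covariance "`C = ((-Δ_{Λ_N})^{α/2} + m²)⁻¹`" (any period `M`; the paper's `M = L^N`).
[cite: Slade2017, §4.1 ("with m² > 0 and C = ((-Δ_{Λ_N})^{α/2}+m²)⁻¹")] -/
abbrev gaussianPC (d M n : ℕ) [NeZero M] (α m2 : ℝ) : Measure (TorusSite d M → Fin n → ℝ) :=
  fieldGaussian (TorusSite d M) (covInvMatrix d (α / 2) M m2)⁻¹ n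

/-- `Z_0(φ) = e^{-V_0(φ)}`, `V_0 = Σ_x (g_0 τ_x² + ν_0 τ_x)`. [cite: Slade2017, §4.1 (definition of Z_0)] -/
abbrev Z0 [NeZero M] (g ν₀ : ℝ) (φ : TorusSite d M → Fin n → ℝ) : ℝ :=
  Real.exp (-sitePotential g ν₀ φ)

/-- `q_{C⁻¹} = (ζ, C⁻¹ζ)` is the form `covInvForm` of the sibling file. [cite: Slade2017, §4.1 (Gaussian measure P_C)] -/
theorem compForm_covInvMatrix [NeZero M] (α m2 : ℝ) (φ : TorusSite d M → Fin n → ℝ) :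
    compForm (covInvMatrix d (α / 2) M m2) φ = covInvForm d M n α m2 φ :=
  (covInvForm_eq_sum_dotProduct α m2 φ).symm

/-- `P_C = e^{-½(ζ, C⁻¹ζ)} dζ / ∫ e^{-½(ζ,C⁻¹ζ)} dζ` for the long-range covariance (`m² > 0`,
`d ≥ 1`, `α ∈ (0,2)`): the Gaussian of §4.1 is a genuine, normalised density.
[cite: Slade2017, §4.1 (Gaussian measure P_C)] -/
theorem gaussianPC_eq_tilted (hd : 1 ≤ d) [NeZero M] {α : ℝ} (hα0 : 0 < α) (hα2 : α < 2)
    {m2 : ℝ} (hm2 : 0 < m2) :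
    gaussianPC d M n α m2 =
      (volume : Measure (TorusSite d M → Fin n → ℝ)).tilted fun ζ => -(covInvForm d M n α m2 ζ) / 2 := by
  rw [gaussianPC, fieldGaussian_inv_eq_tilted
    (posDef_covInvMatrix hd (by positivity) (by linarith) hm2)]
  simp_rw [compForm_covInvMatrix]

/-- The Gaussian weight `e^{-½(ζ,C⁻¹ζ)}` of the long-range covariance is Lebesgue integrable.
[cite: Slade2017, §4.1 (Gaussian measure P_C)] -/
theorem integrable_exp_neg_covInvForm (hd : 1 ≤ d) [NeZero M] {α : ℝ} (hα0 : 0 < α) (hα2 : α < 2)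
    {m2 : ℝ} (hm2 : 0 < m2) :
    Integrable fun ζ : TorusSite d M → Fin n → ℝ => Real.exp (-(covInvForm d M n α m2 ζ) / 2) := by
  have h := integrable_exp_neg_compForm (n := n)
    (posDef_covInvMatrix (M := M) hd (by positivity : 0 < α / 2) (by linarith) hm2)
  simp_rw [compForm_covInvMatrix] at h
  exact h

/-- **Slade's `⟨F⟩_{g,ν,N} = E_C F Z_0/E_C Z_0`, measure form: the interacting measure is the
Gaussian `P_C` tilted by
`Z_0 = e^{-V_0}`.** For `m² > 0`, `g_0 = g`, `ν_0 = ν - m²`: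
`e^{-V_{g,ν}}dφ/Z = Z_0 dP_C / E_C Z_0` with `C = ((-Δ_Λ)^{α/2} + m²)⁻¹` ("part of the `τ` term
has been shifted into the Gaussian measure").
[cite: Slade2017, §4.1 (display ⟨F⟩_{g,ν,N} = E_C F Z_0 / E_C Z_0)] -/
theorem gibbsMeasure_eq_gaussianPC_tilted (hd : 1 ≤ d) [NeZero M] {α : ℝ} (hα0 : 0 < α)
    (hα2 : α < 2) (g ν₀ : ℝ) {m2 : ℝ} (hm2 : 0 < m2) :
    gibbsMeasure d M n α g (ν₀ + m2) =
      (gaussianPC d M n α m2).tilted fun φ => -sitePotential g ν₀ φ := by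
  rw [gaussianPC_eq_tilted hd hα0 hα2 hm2, tilted_tilted (integrable_exp_neg_covInvForm hd hα0 hα2 hm2),
    gibbsMeasure]
  congr 1
  funext φ
  rw [Pi.add_apply, potential_eq_sitePotential_add_covInvForm]
  ring

/-- **Slade, §4.1: `⟨F⟩_{g,ν,N} = E_C(F Z_0) / E_C Z_0`** with `Z_0 = e^{-V_0}`, `g_0 = g`,
`ν_0 = ν - m²`, `C = ((-Δ_{Λ_N})^{α/2} + m²)⁻¹`, for every `m² > 0` (`d ≥ 1`, `α ∈ (0,2)`, any
`g, ν_0`, any observable `F`; both sides are `0` for non-integrable data).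
[cite: Slade2017, §4.1 (display ⟨F⟩_{g,ν,N} = E_C F Z_0 / E_C Z_0)] -/
theorem expect_eq_gaussianPC (hd : 1 ≤ d) [NeZero M] {α : ℝ} (hα0 : 0 < α) (hα2 : α < 2)
    (g ν₀ : ℝ) {m2 : ℝ} (hm2 : 0 < m2) (F : (TorusSite d M → Fin n → ℝ) → ℝ) :
    expect d M n α g (ν₀ + m2) F =
      (∫ φ, F φ * Z0 g ν₀ φ ∂(gaussianPC d M n α m2)) / ∫ φ, Z0 g ν₀ φ ∂(gaussianPC d M n α m2) := by
  rw [expect, gibbsMeasure_eq_gaussianPC_tilted hd hα0 hα2 g ν₀ hm2, integral_tilted]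
  simp_rw [smul_eq_mul, div_mul_eq_mul_div, mul_comm (Real.exp _) (F _)]
  rw [integral_div]

/-- **Slade, §4.1 (last three displays): the finite-volume susceptibility as a Gaussian ratio**,
`χ_N(g, ν_0 + m²) = χ̂_N(g, m², ν_0) = n⁻¹ Σ_{x∈Λ_N} E_C((φ_0·φ_x) Z_0) / E_C Z_0`.
[cite: Slade2017, §4.1 (definition of χ̂_N; last display χ_N(g,ν_0+m²) = χ̂_N(g,m²,ν_0))] -/
theorem torusSusceptibility_eq_gaussianPC (hd : 1 ≤ d) [NeZero M] {α : ℝ} (hα0 : 0 < α)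
    (hα2 : α < 2) (g ν₀ : ℝ) {m2 : ℝ} (hm2 : 0 < m2) :
    torusSusceptibility d M n α g (ν₀ + m2) =
      (n : ℝ)⁻¹ * ∑ x : TorusSite d M,
        (∫ φ, (∑ i, φ 0 i * φ x i) * Z0 g ν₀ φ ∂(gaussianPC d M n α m2)) /
          ∫ φ, Z0 g ν₀ φ ∂(gaussianPC d M n α m2) := by
  unfold torusSusceptibility
  congr 1
  exact Finset.sum_congr rfl fun x _ => expect_eq_gaussianPC hd hα0 hα2 g ν₀ hm2 _

/-- **`Z_N(φ) = (E_C θ Z_0)(φ) = E_C Z_0(φ + ζ)`** (Slade §4.1), for the long-range covariance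
`C = ((-Δ_Λ)^{α/2} + m²)⁻¹` on the torus of period `M` (the paper's `M = L^N`) and
`Z_0 = e^{-V_0}`. [cite: Slade2017, §4.1 (definition of Z_N)] -/
def ZN (d M n : ℕ) [NeZero M] (α g ν₀ m2 : ℝ) : (TorusSite d M → Fin n → ℝ) → ℝ :=
  thetaConv (gaussianPC d M n α m2) (Z0 g ν₀)

/-- `Z_N(φ) = E_C Z_0(φ + ζ)`. [cite: Slade2017, §4.1 (definition of Z_N)] -/
theorem ZN_apply [NeZero M] (α g ν₀ m2 : ℝ) (φ : TorusSite d M → Fin n → ℝ) :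
    ZN d M n α g ν₀ m2 φ = ∫ ζ, Z0 g ν₀ (φ + ζ) ∂(gaussianPC d M n α m2) := rfl

/-- "Then `Z_N(0) = E_C Z_0`." [cite: Slade2017, §4.1 (definition of Z_N)] -/
theorem ZN_zero [NeZero M] (α g ν₀ m2 : ℝ) :
    ZN d M n α g ν₀ m2 0 = ∫ ζ, Z0 g ν₀ ζ ∂(gaussianPC d M n α m2) :=
  thetaConv_zero_left _ _

/-- The unnormalised Gaussian convolution `gaussConvZ0` of
`RigorousRGSmallParameterSusceptibilityFormula.lean` (`∫ e^{-V_0(ψ+ζ)} e^{-½(ζ,C⁻¹ζ)} dζ`) is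
`Z_N(ψ)` times the Gaussian normalisation `∫ e^{-½(ζ,C⁻¹ζ)} dζ`. [cite: Slade2017, §4.1 (definition of Z_N)] -/
theorem gaussConvZ0_eq_mul_ZN (hd : 1 ≤ d) [NeZero M] {α : ℝ} (hα0 : 0 < α) (hα2 : α < 2)
    (g ν₀ : ℝ) {m2 : ℝ} (hm2 : 0 < m2) (ψ : TorusSite d M → Fin n → ℝ) :
    gaussConvZ0 d M n α g ν₀ m2 ψ =
      (∫ ζ : TorusSite d M → Fin n → ℝ, Real.exp (-(covInvForm d M n α m2 ζ) / 2)) *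
        ZN d M n α g ν₀ m2 ψ := by
  have hZ : 0 < ∫ ζ : TorusSite d M → Fin n → ℝ, Real.exp (-(covInvForm d M n α m2 ζ) / 2) :=
    integral_exp_pos (integrable_exp_neg_covInvForm hd hα0 hα2 hm2)
  rw [ZN_apply, gaussianPC_eq_tilted hd hα0 hα2 hm2, integral_tilted]
  simp_rw [smul_eq_mul, div_mul_eq_mul_div]
  rw [integral_div, mul_div_cancel₀ _ hZ.ne', gaussConvZ0]
  refine integral_congr_ae (Eventually.of_forall fun ζ => ?_)
  simp only [Z0]
  rw [mul_comm, neg_div]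

/-- **The partition function through `Z_N`**: `∫ e^{-V_{g,ν₀+m²}(φ)} dφ = (∫ e^{-½(ζ,C⁻¹ζ)}dζ) · Z_N(0)`,
i.e. `Z_{g,ν,N} = E_C Z_0` up to the Gaussian normalisation.
[cite: Slade2017, §4.1 (display ⟨F⟩ = E_C F Z_0/E_C Z_0 and definition of Z_N)] -/
theorem integral_exp_neg_potential_eq (hd : 1 ≤ d) [NeZero M] {α : ℝ} (hα0 : 0 < α) (hα2 : α < 2)
    (g ν₀ : ℝ) {m2 : ℝ} (hm2 : 0 < m2) :
    ∫ φ : TorusSite d M → Fin n → ℝ, Real.exp (-potential d M n α g (ν₀ + m2) φ) =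
      (∫ ζ : TorusSite d M → Fin n → ℝ, Real.exp (-(covInvForm d M n α m2 ζ) / 2)) *
        ZN d M n α g ν₀ m2 0 := by
  rw [← gaussConvZ0_eq_mul_ZN hd hα0 hα2 g ν₀ hm2, gaussConvZ0]
  refine integral_congr_ae (Eventually.of_forall fun φ => ?_)
  simp only [zero_add]
  rw [potential_eq_sitePotential_add_covInvForm, neg_add, Real.exp_add]

/-! #### `Z_0` is bounded and measurable; `Z_N` by progressive integration -/

/-- Completing the square: for `g > 0`, `¼ g s² + ½ ν₀ s ≥ -ν₀²/(4g)`. [folklore] -/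
theorem quartic_lower_bound {g : ℝ} (hg : 0 < g) (ν₀ s : ℝ) :
    -(ν₀ ^ 2 / (4 * g)) ≤ g / 4 * s ^ 2 + ν₀ / 2 * s := by
  have h : g / 4 * s ^ 2 + ν₀ / 2 * s + ν₀ ^ 2 / (4 * g) = g / 4 * (s + ν₀ / g) ^ 2 := by
    field_simp
    ring
  nlinarith [h, mul_nonneg (by positivity : (0 : ℝ) ≤ g / 4) (sq_nonneg (s + ν₀ / g))]

/-- `V_0 ≥ -|Λ| ν₀²/(4g)` for `g > 0`. [folklore] -/
theorem sitePotential_ge [NeZero M] {g : ℝ} (hg : 0 < g) (ν₀ : ℝ) (φ : TorusSite d M → Fin n → ℝ) :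
    -((Fintype.card (TorusSite d M) : ℝ) * (ν₀ ^ 2 / (4 * g))) ≤ sitePotential g ν₀ φ := by
  unfold sitePotential
  have h := Finset.sum_le_sum fun x (_ : x ∈ (Finset.univ : Finset (TorusSite d M))) =>
    quartic_lower_bound hg ν₀ (sqNorm (φ x))
  rw [Finset.sum_const, Finset.card_univ, nsmul_eq_mul] at h
  linarith

/-- **`Z_0 = e^{-V_0}` is bounded** (`g > 0`): `0 < Z_0 ≤ e^{|Λ|ν₀²/(4g)}`. [folklore] -/
theorem abs_Z0_le [NeZero M] {g : ℝ} (hg : 0 < g) (ν₀ : ℝ) (φ : TorusSite d M → Fin n → ℝ) :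
    |Z0 g ν₀ φ| ≤ Real.exp ((Fintype.card (TorusSite d M) : ℝ) * (ν₀ ^ 2 / (4 * g))) := by
  rw [abs_of_pos (Real.exp_pos _), Real.exp_le_exp]
  have := sitePotential_ge (n := n) hg ν₀ φ
  linarith

/-- `Z_0` is a continuous function of the field. [folklore] -/
theorem continuous_Z0 [NeZero M] (g ν₀ : ℝ) : Continuous (Z0 (d := d) (M := M) (n := n) g ν₀) := by
  unfold Z0 sitePotential sqNorm
  fun_prop

/-- `Z_0` is measurable. [folklore] -/
theorem measurable_Z0 [NeZero M] (g ν₀ : ℝ) : Measurable (Z0 (d := d) (M := M) (n := n) g ν₀) :=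
  (continuous_Z0 g ν₀).measurable

/-- `Z_0(φ + ·)` is `P`-integrable for every finite measure `P` (`g > 0`). [folklore] -/
theorem integrable_Z0_comp_add [NeZero M] {g : ℝ} (hg : 0 < g) (ν₀ : ℝ)
    (P : Measure (TorusSite d M → Fin n → ℝ)) [IsFiniteMeasure P] (φ : TorusSite d M → Fin n → ℝ) :
    Integrable (fun ζ => Z0 g ν₀ (φ + ζ)) P :=
  integrable_comp_add_of_bounded (measurable_Z0 g ν₀) (abs_Z0_le hg ν₀) φ

/-- **`Z_N > 0`** (`g > 0`). [cite: Slade2017, §4.1 (definition of Z_N)] -/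
theorem ZN_pos [NeZero M] (α : ℝ) {g : ℝ} (hg : 0 < g) (ν₀ m2 : ℝ) (φ : TorusSite d M → Fin n → ℝ) :
    0 < ZN d M n α g ν₀ m2 φ :=
  integral_exp_pos (integrable_Z0_comp_add hg ν₀ _ φ)

/-- `|Z_N| ≤ e^{|Λ|ν₀²/(4g)}` (`g > 0`). [folklore] -/
theorem abs_ZN_le [NeZero M] (α : ℝ) {g : ℝ} (hg : 0 < g) (ν₀ m2 : ℝ) (φ : TorusSite d M → Fin n → ℝ) :
    |ZN d M n α g ν₀ m2 φ| ≤ Real.exp ((Fintype.card (TorusSite d M) : ℝ) * (ν₀ ^ 2 / (4 * g))) :=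
  abs_thetaConv_le (abs_Z0_le hg ν₀) φ

/-- **Slade's `Z_{j+1} = E_{C_{j+1}}θZ_j ⟹ Z_N = E_CθZ_0` for the long-range model**: for ANY
decomposition
`C = ((-Δ_Λ)^{α/2} + m²)⁻¹ = C_0 + ⋯ + C_{N'-1}` into positive semidefinite matrices (such as the
finite-range decomposition `Σ_{j<N} C_j + C_{N,N}` of §3.2), progressive integration
`Z_{j+1} = E_{C_j} θ Z_j` started at `Z_0 = e^{-V_0}` ends at `Z_N = E_C θ Z_0` (`g > 0`).
[cite: Slade2017, §4.1 (displays Z_{j+1} = E_{C_{j+1}}θZ_j and Z_N = E_CθZ_0)] -/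
theorem progressive_eq_ZN [NeZero M] {α : ℝ} {g : ℝ} (hg : 0 < g) (ν₀ m2 : ℝ)
    {C : ℕ → Matrix (TorusSite d M) (TorusSite d M) ℝ} {N' : ℕ} (hC : ∀ j < N', (C j).PosSemidef)
    (hsum : ∑ j ∈ Finset.range N', C j = (covInvMatrix d (α / 2) M m2)⁻¹) :
    progressive (fun j => fieldGaussian (TorusSite d M) (C j) n) (Z0 g ν₀) N' = ZN d M n α g ν₀ m2 := by
  rw [progressive_fieldGaussian_eq hC (measurable_Z0 g ν₀) (abs_Z0_le hg ν₀), hsum]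
  rfl

end Model

end LongRangePhi4

end Literature.Barriers.CriticalPhenomena
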